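import Mathlib
import Summits.Ventures.HodgeRepro.Tier4.Common.AdelicDefs
import Summits.Ventures.HodgeRepro.Tier4.Line1.RationalPoints
import Summits.Ventures.HodgeRepro.Tier4.Line1.FundamentalDomainOfCompact
import Summits.Ventures.HodgeRepro.Tier4.Line1.RightInvariantOfFundamentalDomain

/-!
# Tier4/Line1/CocompactReduction — (I1-c), (I1-c′), (I1-c″), (I1-d) of LINE L1 reduced to cocompactness

Blind re-derivation cell `pub-hodge-repro`, Tier 4 (README §9–§10), seat t4-L1-p5 (prover, LINE L1, gen 0).
The compactness theorems of `Skeleton.lean` v0.8 (12c8528bc811170c…, L521 `quotient_compact`, L530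
`torus_quotient_compact`, L536 `torus'_quotient_compact`) ask, for every Haar measure on `U(W)(𝔸_k)` (resp. on the
tori `T`, `T′`), a fundamental domain of the rational points with compact closure.  With the generic reduction of
`Tier4/Line1/FundamentalDomainOfCompact.lean` (a discrete countable subgroup `Γ` with a compact `C`, `Γ · C = G`, has a
measurable fundamental domain inside `C`) and the discreteness (I1-a) of `Tier4/Line1/RationalPoints.lean`, each of
them follows from the PURELY TOPOLOGICAL statement «`Γ\G` is compact», i.e. `∃ C compact, Γ · C = G`, proved here as the
three `…_of_cocompact` theorems.  The file also supplies the countability of `U(W)(k)` (it injects into `M₄(k)`, and a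
number field is countable) and the discreteness / countability of the rational points of any subgroup `S ≤ U(W)(𝔸_k)`
(`rationalOf W S`), as subgroups of (I1-a)'s discrete countable group.

(I1-d) `haar_rightInvariant` (L544) is reduced likewise, through `Tier4/Line1/RightInvariantOfFundamentalDomain.lean`:
given the fundamental domain of (I1-c) and the local compactness and σ-compactness of `U(W)(𝔸_k)`, every Haar measure
is right invariant (`haar_rightInvariant_of_quotient_compact`).

What remains of (I1-c/c′/c″/d) after this file: the cocompactness hypotheses themselves — Borel–Harish-Chandra / Godement
for the definite plane (W42), Fujisaki / Weil BNT IV §4 Thm 6 for the anisotropic tori (W43) — and, for (I1-d), the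
local compactness and σ-compactness of `U(W)(𝔸_k)`.  Mathlib (rev 81a5d257c8e4) has none of these (no cocompactness
of `k` in `𝔸_k`, no adelic Minkowski lemma, no compactness of the local integers `𝓞_v`, no local compactness of the
finite adele ring); they are recorded in the line's repair census.

Nothing here says anything about the status of the Hodge conjecture for CM abelian varieties, which is NOT proved
(HC_CM is NOT proved by anyone in this repository).
-/

set_option autoImplicit false

noncomputable section

namespace Summit.Ventures.HodgeRepro.Tier4.Line1

open NumberField Common MeasureTheory Topology

section Instance

variable {k : Type} [Field k] [NumberField k] (W : PlaneData k)

/-- A number field is countable (a finite-dimensional `ℚ`-vector space). -/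
theorem countable_numberField : Countable k := Finsupp.Countable.of_moduleFinite (R := ℚ)

/-- **`U(W)(k)` is countable**: every rational point is the image of a unique `A ∈ GL₄(k)`, and `M₄(k)` is countable. -/
theorem rationalPoints_countable : Countable (rationalPoints W) := by
  haveI : Countable k := countable_numberField (k := k)
  haveI : Countable (Matrix (Fin 4) (Fin 4) k) :=
    inferInstanceAs (Countable (Fin 4 → Fin 4 → k))
  -- the chosen rational matrix of a rational point
  have hmem : ∀ g : rationalPoints W, ∃ A : GL (Fin 4) k,
      Matrix.GeneralLinearGroup.map (algebraMap k (Ad k)) A = ((g : GA W) : GL4 k) := fun g =>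
    MonoidHom.mem_range.1 g.2
  let φ : rationalPoints W → Matrix (Fin 4) (Fin 4) k := fun g => Units.val (Classical.choose (hmem g))
  have hφ : Function.Injective φ := by
    intro g h hgh
    have e : Classical.choose (hmem g) = Classical.choose (hmem h) := Units.ext hgh
    have hg := Classical.choose_spec (hmem g)
    have hh := Classical.choose_spec (hmem h)
    rw [e, hh] at hg
    exact Subtype.ext (Subtype.ext hg.symm)
  exact hφ.countable

/-- The rational points of a subgroup `S ≤ U(W)(𝔸_k)` are discrete (they inject continuously into the discrete
`U(W)(k)` of (I1-a)). -/
theorem rationalOf_discrete (S : Subgroup (GA W)) : DiscreteTopology (rationalOf W S) := by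
  haveI := rationalPoints_discrete W
  refine DiscreteTopology.of_continuous_injective
    (f := fun g : rationalOf W S => (⟨((g : S) : GA W), g.2⟩ : rationalPoints W)) ?_ ?_
  · exact Continuous.subtype_mk (continuous_subtype_val.comp continuous_subtype_val) _
  · intro g h hgh
    simp only [Subtype.mk.injEq] at hgh
    exact Subtype.ext (Subtype.ext hgh)

/-- The rational points of a subgroup `S ≤ U(W)(𝔸_k)` are countable. -/
theorem rationalOf_countable (S : Subgroup (GA W)) : Countable (rationalOf W S) := by
  haveI := rationalPoints_countable W
  exact Function.Injective.countable
    (f := fun g : rationalOf W S => (⟨((g : S) : GA W), g.2⟩ : rationalPoints W))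
    (fun g h hgh => by
      simp only [Subtype.mk.injEq] at hgh
      exact Subtype.ext (Subtype.ext hgh))

/-- (I1-c) REDUCED (Skeleton.lean L521): if `U(W)(k)\U(W)(𝔸_k)` is compact — a compact `C` with
`U(W)(k) · C = U(W)(𝔸_k)` — then every measure on `U(W)(𝔸_k)` has a fundamental domain of the rational points with
compact closure. -/
theorem quotient_compact_of_cocompact [MeasurableSpace (GA W)] [BorelSpace (GA W)] (μ : Measure (GA W))
    (hcc : ∃ C : Set (GA W), IsCompact C ∧
      ∀ x : GA W, ∃ γ : rationalPoints W, ∃ c ∈ C, x = (γ : GA W) * c) :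
    ∃ D : Set (GA W), IsFundamentalDomain (rationalPoints W) D μ ∧ IsCompact (closure D) := by
  haveI := t2Space_GA W
  haveI := rationalPoints_discrete W
  haveI := rationalPoints_countable W
  obtain ⟨C, hC, hcov⟩ := hcc
  exact exists_isFundamentalDomain_isCompact_closure_of_isCompact (rationalPoints W) μ hC hcov

/-- The same reduction for any subgroup `S ≤ U(W)(𝔸_k)` with its rational points `rationalOf W S`. -/
theorem subgroup_quotient_compact_of_cocompact (S : Subgroup (GA W)) [MeasurableSpace S] [BorelSpace S]
    (μ : Measure S)
    (hcc : ∃ C : Set S, IsCompact C ∧ ∀ x : S, ∃ γ : rationalOf W S, ∃ c ∈ C, x = (γ : S) * c) :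
    ∃ D : Set S, IsFundamentalDomain (rationalOf W S) D μ ∧ IsCompact (closure D) := by
  haveI := t2Space_GA W
  haveI := rationalOf_discrete W S
  haveI := rationalOf_countable W S
  obtain ⟨C, hC, hcov⟩ := hcc
  exact exists_isFundamentalDomain_isCompact_closure_of_isCompact (rationalOf W S) μ hC hcov

/-- (I1-c′) REDUCED (Skeleton.lean L530): cocompactness of `T(k)` in `T(𝔸_k)` gives the fundamental domain. -/
theorem torus_quotient_compact_of_cocompact [MeasurableSpace (GA W)] [BorelSpace (GA W)]
    (μT : Measure (torusT W))
    (hcc : ∃ C : Set (torusT W), IsCompact C ∧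
      ∀ x : torusT W, ∃ γ : rationalOf W (torusT W), ∃ c ∈ C, x = (γ : torusT W) * c) :
    ∃ D : Set (torusT W), IsFundamentalDomain (rationalOf W (torusT W)) D μT ∧ IsCompact (closure D) :=
  subgroup_quotient_compact_of_cocompact W (torusT W) μT hcc

/-- (I1-c″) REDUCED (Skeleton.lean L536): the same for `T′`. -/
theorem torus'_quotient_compact_of_cocompact [MeasurableSpace (GA W)] [BorelSpace (GA W)]
    (μT' : Measure (torusT' W))
    (hcc : ∃ C : Set (torusT' W), IsCompact C ∧
      ∀ x : torusT' W, ∃ γ : rationalOf W (torusT' W), ∃ c ∈ C, x = (γ : torusT' W) * c) :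
    ∃ D : Set (torusT' W), IsFundamentalDomain (rationalOf W (torusT' W)) D μT' ∧ IsCompact (closure D) :=
  subgroup_quotient_compact_of_cocompact W (torusT' W) μT' hcc

/-- (I1-d) REDUCED (Skeleton.lean L544): given the fundamental domain of (I1-c) for `μ`, and `U(W)(𝔸_k)` locally
compact and σ-compact, the Haar measure `μ` is right invariant. -/
theorem haar_rightInvariant_of_quotient_compact [MeasurableSpace (GA W)] [BorelSpace (GA W)]
    [LocallyCompactSpace (GA W)] [SigmaCompactSpace (GA W)] (μ : Measure (GA W)) [μ.IsHaarMeasure]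
    (hq : ∃ D : Set (GA W), IsFundamentalDomain (rationalPoints W) D μ ∧ IsCompact (closure D)) :
    μ.IsMulRightInvariant := by
  haveI := rationalPoints_countable W
  obtain ⟨D, hD, hDc⟩ := hq
  exact isMulRightInvariant_of_isFundamentalDomain μ (rationalPoints W) hD hDc

end Instance

end Summit.Ventures.HodgeRepro.Tier4.Line1

end
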